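import Summits.BirchSwinnertonDyer.BirchSwinnertonDyer.Theorems.BiquadraticEisensteinDescentHeegnerTwistCouplingInSupplySqrtTwoAllFiveCellData
import Summits.BirchSwinnertonDyer.BirchSwinnertonDyer.Theorems.BiquadraticEisensteinDescentHeegnerTwistCouplingInSupplySqrtTwoCruxOnFamily
import Summits.BirchSwinnertonDyer.BirchSwinnertonDyer.Theorems.BiquadraticEisensteinDescentHeegnerTwistCouplingInSupplySqrtTwoCornerFifteenMinimal
import HarnessLib

set_option linter.dupNamespace false -- `Summit.BirchSwinnertonDyer.BirchSwinnertonDyer.Theorems.…` (summit = sub)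
set_option autoImplicit false

/-!
# Crux `HeegnerTwistCouplingInSupply` (stmt-BirchSwinnertonDyer-21381) — ★★★ the `j = 8000` corner for EVERY prime `p ≡ 5 (mod 8)`,
# both isogeny members `W ∈ {B_p, B_{−2p}}`, modulo Burungale–Tian + Deuring–Hecke: the `2⁻¹³` residual of the partner ladder is gone

Route `BiquadraticEisensteinDescent` (cell `pub/bsd-wall`, width seat `bsd-wall-cm-bed-w2` g13; `--supports` 21381, helper). Assembly of
`…SqrtTwoAllFiveCellData.exists_cellData_five_all` (for every prime `p ≡ 5 (mod 8)`: primes `ℓ ≡ 3`, `q₀ ≡ 5 (mod 8)`, both non-residues mod `p`,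
`h(−ℓq₀) < p` — Fermat pin + rounding trichotomy + class number formula above `11100`, kernel table below) with the CELL-5 machinery of the
`j = 8000` corner (w1 g10: `…SqrtTwoCorner.L_one_ne_zero_B_neg`, `eq_two_or_eq_of_prime_dvd_conductorNorm_B`; dual member w1/w2:
`…SqrtTwoDualCorner.L_one_ne_zero_dual_of_primes`, `eq_two_or_eq_of_prime_dvd_conductorNorm_Bdual`; field `…PartnerLadder.exists_witnessField_of`):

* ★★★ `cruxOnBpCornerAllFive_of_two_facts` — for EVERY prime `p ≡ 5 (mod 8)` and `W = B_p = ⟨0, 4p, 0, 2p², 0⟩`: a Heegner field `K′ = ℚ(√−ℓq₀)` of `N(B_p)`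
  with `4 < |d_{K′}|`, `L(B_p^{(d_{K′})}, 1) ≠ 0`, `h(K′) < p`, `p ∤ h(K′)` — the statement of `…SqrtTwoLadder.cruxOnBpCornerPartner_of_two_facts` /
  `…SqrtTwoWindow.cruxOnBpCornerWindow_of_two_facts` with the partner hypotheses DELETED; ★★★ `cruxOnBdualCornerAllFive_of_two_facts` — the same for
  `W = B_{−2p} = ⟨0, −8p, 0, 8p², 0⟩`; `cruxOnBpCornerAllFive` — `[Fact p.Prime]` the only binder (`isElliptic_Bp`, `isGloballyMinimal_B`, `neZero_conductorNorm_B`);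
* ★★ `heegnerTwistCouplingInSupply_of_eq_B_five` / `…_of_eq_Bdual_five` — the BODY of the route decl with the single extra hypothesis «`W = B_p`
  (resp. `B_{−2p}`), `p` prime `≡ 5 (mod 8)`» (the window versions of `…SqrtTwoCruxOnFamily` with the window hypothesis removed).

With w2 g12's `p ≡ 15 (mod 16)` corners, the `j = 8000` corner now holds on the whole inert habitat EXCEPT the class `p ≡ 7 (mod 16)` (no 2-descent cell:
`2 ± √2` non-squares). HONEST FRAMING: a typed sub-corner on one CM family; named facts = Burungale–Tian's rank-zero `2`-converse + Deuring–Hecke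
continuation for `j = 8000` (`hasEntireLFunction_of_j_mem_maximalCMJInvariants`); the crux (all CM `W`; residual C⁺) is NOT closed; BSD is not proved by
any of this. THEOREMS ONLY. Supports stmt-BirchSwinnertonDyer-21381.
-/

noncomputable section

open scoped Classical

namespace Summit.BirchSwinnertonDyer.BirchSwinnertonDyer.Theorems.BiquadraticEisensteinDescentHeegnerTwistCouplingInSupplySqrtTwoAllFive

open _root_.WeierstrassCurve Literature.NumberTheory.EllipticCurves Literature.NumberTheory.EllipticCurves.HeathBrown1994.Families
open Literature.NumberTheory.EllipticCurves.Rank1Residual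
open Summit.BirchSwinnertonDyer.BirchSwinnertonDyer.Theorems.BiquadraticEisensteinDescentHeegnerTwistCouplingInSupplySqrtTwoCell
open Summit.BirchSwinnertonDyer.BirchSwinnertonDyer.Theorems.BiquadraticEisensteinDescentHeegnerTwistCouplingInSupplySqrtTwoCorner
open Summit.BirchSwinnertonDyer.BirchSwinnertonDyer.Theorems.BiquadraticEisensteinDescentHeegnerTwistCouplingInSupplySqrtTwoLadder
open Summit.BirchSwinnertonDyer.BirchSwinnertonDyer.Theorems.BiquadraticEisensteinDescentHeegnerTwistCouplingInSupplySqrtTwoDual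
open Summit.BirchSwinnertonDyer.BirchSwinnertonDyer.Theorems.BiquadraticEisensteinDescentHeegnerTwistCouplingInSupplySqrtTwoDualCorner
open Summit.BirchSwinnertonDyer.BirchSwinnertonDyer.Theorems.BiquadraticEisensteinDescentHeegnerTwistCouplingInSupplyPartnerLadder
open Summit.BirchSwinnertonDyer.BirchSwinnertonDyer.Theorems.BiquadraticEisensteinDescentHeegnerTwistCouplingInSupplySqrtTwoCornerFifteenMinimal
  (isGloballyMinimal_B neZero_conductorNorm_B isElliptic_Bp)
open Summit.BirchSwinnertonDyer.BirchSwinnertonDyer.Theorems.BiquadraticEisensteinDescentHeegnerTwistCouplingInSupplySqrtTwoCruxOnFamily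
  (eq_of_not_good_B eq_of_not_good_Bdual)
open Summit.BirchSwinnertonDyer.BirchSwinnertonDyer.Theorems.BiquadraticEisensteinDescentHeegnerTwistCouplingInSupplySqrtTwoAllFiveCellData
  (exists_cellData_five_all)

/-! ## §1 ★★★ The corner for every prime `p ≡ 5 (mod 8)` -/

/-- ★★★ **THE `j = 8000` CORNER `W = B_p` FOR EVERY PRIME `p ≡ 5 (mod 8)`, TWO NAMED FACTS** (Burungale–Tian + Deuring–Hecke): a Heegner field
`K′ = ℚ(√−ℓq₀)` of `N(B_p)` with `4 < |d_{K′}|`, `L(B_p^{(d_{K′})}, 1) ≠ 0` (CELL-5 at `m = pℓq₀`), `h(K′) < p`, `p ∤ h(K′)` — no partner hypothesis, no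
threshold, no residual (cell data `exists_cellData_five_all`). [cite: BurungaleTian2026, Thm. 1.1] [cite: SilvermanAEC2009, Prop. X.4.9 and Thm. X.4.2(a)]
[cite: Oesterle1988Gauss, II §3 Proposition p. 57 (27)] -/
theorem cruxOnBpCornerAllFive_of_two_facts (hBT : burungaleTian_analyticRank_eq_zero_of_selmerCorank_eq_zero_of_hasCM)
    (hH : hasEntireLFunction_of_j_mem_maximalCMJInvariants) :
    ∀ (p : ℕ) [Fact p.Prime] [(⟨0, 4 * (p : ℚ), 0, 2 * (p : ℚ) ^ 2, 0⟩ : WeierstrassCurve ℚ).IsElliptic]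
      [(⟨0, 4 * (p : ℚ), 0, 2 * (p : ℚ) ^ 2, 0⟩ : WeierstrassCurve ℚ).IsGloballyMinimal]
      [NeZero ((⟨0, 4 * (p : ℚ), 0, 2 * (p : ℚ) ^ 2, 0⟩ : WeierstrassCurve ℚ).conductorNorm ℤ)],
      p % 8 = 5 →
      ∃ (K : Type) (_ : Field K) (_ : NumberField K),
        IsImaginaryQuadratic K ∧ 4 < (NumberField.discr K).natAbs ∧
        SatisfiesHeegnerHypothesis ((⟨0, 4 * (p : ℚ), 0, 2 * (p : ℚ) ^ 2, 0⟩ : WeierstrassCurve ℚ).conductorNorm ℤ) K ∧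
        ((⟨0, 4 * (p : ℚ), 0, 2 * (p : ℚ) ^ 2, 0⟩ : WeierstrassCurve ℚ).quadraticTwist (NumberField.discr K : ℚ)).entireLFunction 1 ≠ 0 ∧
        NumberField.classNumber K < p ∧ ¬ p ∣ NumberField.classNumber K := by
  intro p hpF _ _ _ hp8
  have hp : p.Prime := hpF.out
  obtain ⟨ℓ, q₀, hℓ, hℓ8, hq₀, hq₀8, hJℓ, hJq, hh⟩ := exists_cellData_five_all hp hp8
  have hJ : jacobiSym (-((ℓ * q₀ : ℕ) : ℤ)) p = 1 := jacobiSym_neg_mul_eq_one_of_mod_four_eq_one (by omega) hJℓ hJq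
  obtain ⟨K, iF, iN, hK, hdK, hH', hcl⟩ := exists_witnessField_of
    (N := (⟨0, 4 * (p : ℚ), 0, 2 * (p : ℚ) ^ 2, 0⟩ : WeierstrassCurve ℚ).conductorNorm ℤ) hℓ hℓ8 hq₀ hq₀8 hJ hh
    (fun r hr hrN => eq_two_or_eq_of_prime_dvd_conductorNorm_B hp hr hrN)
  refine ⟨K, iF, iN, hK, ?_, hH', ?_, hcl, fun hdvd =>
    absurd (Nat.le_of_dvd (NumberField.classNumber_pos K) hdvd) (not_le.mpr hcl)⟩
  · rw [hdK, Int.natAbs_neg, Int.natAbs_natCast]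
    have h3 : 3 ≤ ℓ := by have := hℓ.two_le; omega
    have h5 : 5 ≤ q₀ := by have := hq₀.two_le; omega
    nlinarith
  · rw [hdK, quadraticTwist_B_neg_mul]
    have hℓq : ℓ ≠ q₀ := by rintro rfl; omega
    obtain ⟨hsq, hfac⟩ := squarefree_mul_mul_of_primes hp hℓ hq₀ (ne_of_jacobiSym_eq_neg_one hp hJℓ).symm
      (ne_of_jacobiSym_eq_neg_one hp hJq).symm hℓq
    have hm0 : (0 : ℤ) < ((p * ℓ * q₀ : ℕ) : ℤ) := by
      have := hp.pos
      have := hℓ.pos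
      have := hq₀.pos
      positivity
    have hm8 : ∀ r : ℕ, r.Prime → (r : ℤ) ∣ ((p * ℓ * q₀ : ℕ) : ℤ) → r % 8 = 3 ∨ r % 8 = 5 := by
      intro r hr hrd
      rcases hfac r hr (by exact_mod_cast hrd) with rfl | rfl | rfl <;> omega
    haveI := isElliptic_B hm0.ne'
    exact (L_one_ne_zero_B_neg hBT hH hm0 (Int.squarefree_natCast.mpr hsq) hm8).2

/-- ★★★ **THE CORNER FOR THE ISOGENOUS MEMBER `W = B_{−2p}`, EVERY PRIME `p ≡ 5 (mod 8)`, TWO NAMED FACTS** (CELL-5′ at `m = pℓq₀`).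
[cite: BurungaleTian2026, Thm. 1.1] [cite: SilvermanAEC2009, Prop. X.4.9 and Thm. X.4.2(a)] [cite: Oesterle1988Gauss, II §3 Proposition p. 57 (27)] -/
theorem cruxOnBdualCornerAllFive_of_two_facts (hBT : burungaleTian_analyticRank_eq_zero_of_selmerCorank_eq_zero_of_hasCM)
    (hH : hasEntireLFunction_of_j_mem_maximalCMJInvariants) :
    ∀ (p : ℕ) [Fact p.Prime] [(⟨0, -8 * (p : ℚ), 0, 8 * (p : ℚ) ^ 2, 0⟩ : WeierstrassCurve ℚ).IsElliptic]
      [(⟨0, -8 * (p : ℚ), 0, 8 * (p : ℚ) ^ 2, 0⟩ : WeierstrassCurve ℚ).IsGloballyMinimal]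
      [NeZero ((⟨0, -8 * (p : ℚ), 0, 8 * (p : ℚ) ^ 2, 0⟩ : WeierstrassCurve ℚ).conductorNorm ℤ)],
      p % 8 = 5 →
      ∃ (K : Type) (_ : Field K) (_ : NumberField K),
        IsImaginaryQuadratic K ∧ 4 < (NumberField.discr K).natAbs ∧
        SatisfiesHeegnerHypothesis ((⟨0, -8 * (p : ℚ), 0, 8 * (p : ℚ) ^ 2, 0⟩ : WeierstrassCurve ℚ).conductorNorm ℤ) K ∧
        ((⟨0, -8 * (p : ℚ), 0, 8 * (p : ℚ) ^ 2, 0⟩ : WeierstrassCurve ℚ).quadraticTwist (NumberField.discr K : ℚ)).entireLFunction 1 ≠ 0 ∧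
        NumberField.classNumber K < p ∧ ¬ p ∣ NumberField.classNumber K := by
  intro p hpF _ _ _ hp8
  have hp : p.Prime := hpF.out
  obtain ⟨ℓ, q₀, hℓ, hℓ8, hq₀, hq₀8, hJℓ, hJq, hh⟩ := exists_cellData_five_all hp hp8
  have hJ : jacobiSym (-((ℓ * q₀ : ℕ) : ℤ)) p = 1 := jacobiSym_neg_mul_eq_one_of_mod_four_eq_one (by omega) hJℓ hJq
  obtain ⟨K, iF, iN, hK, hdK, hH', hcl⟩ := exists_witnessField_of
    (N := (⟨0, -8 * (p : ℚ), 0, 8 * (p : ℚ) ^ 2, 0⟩ : WeierstrassCurve ℚ).conductorNorm ℤ) hℓ hℓ8 hq₀ hq₀8 hJ hh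
    (fun r hr hrN => eq_two_or_eq_of_prime_dvd_conductorNorm_Bdual hp hr hrN)
  refine ⟨K, iF, iN, hK, ?_, hH', ?_, hcl, fun hdvd =>
    absurd (Nat.le_of_dvd (NumberField.classNumber_pos K) hdvd) (not_le.mpr hcl)⟩
  · rw [hdK, Int.natAbs_neg, Int.natAbs_natCast]
    have h3 : 3 ≤ ℓ := by have := hℓ.two_le; omega
    have h5 : 5 ≤ q₀ := by have := hq₀.two_le; omega
    nlinarith
  · rw [hdK, quadraticTwist_Bdual_neg_mul]
    exact L_one_ne_zero_dual_of_primes hBT hH hp hℓ hq₀ (ne_of_jacobiSym_eq_neg_one hp hJℓ).symm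
      (ne_of_jacobiSym_eq_neg_one hp hJq).symm (by rintro rfl; omega) (Or.inr hp8) (Or.inl hℓ8) (Or.inr hq₀8)

/-- ★★★ **The `B_p` corner for every prime `p ≡ 5 (mod 8)` with NO side binders** (`B_p` is elliptic, a global minimal model, `N(B_p) ≠ 0`:
`isElliptic_Bp`, `isGloballyMinimal_B`, `neZero_conductorNorm_B`). [cite: BurungaleTian2026, Thm. 1.1] [cite: Oesterle1988Gauss, II §3 Proposition p. 57 (27)] -/
theorem cruxOnBpCornerAllFive (hBT : burungaleTian_analyticRank_eq_zero_of_selmerCorank_eq_zero_of_hasCM)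
    (hH : hasEntireLFunction_of_j_mem_maximalCMJInvariants) :
    ∀ (p : ℕ) [Fact p.Prime], p % 8 = 5 →
      haveI := isElliptic_Bp p
      ∃ (K : Type) (_ : Field K) (_ : NumberField K),
        IsImaginaryQuadratic K ∧ 4 < (NumberField.discr K).natAbs ∧
        SatisfiesHeegnerHypothesis ((⟨0, 4 * (p : ℚ), 0, 2 * (p : ℚ) ^ 2, 0⟩ : WeierstrassCurve ℚ).conductorNorm ℤ) K ∧
        ((⟨0, 4 * (p : ℚ), 0, 2 * (p : ℚ) ^ 2, 0⟩ : WeierstrassCurve ℚ).quadraticTwist (NumberField.discr K : ℚ)).entireLFunction 1 ≠ 0 ∧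
        NumberField.classNumber K < p ∧ ¬ p ∣ NumberField.classNumber K := by
  intro p hpF hp8
  haveI := isElliptic_Bp p
  haveI := isGloballyMinimal_B hpF.out (by rintro rfl; omega)
  haveI := neZero_conductorNorm_B p
  exact cruxOnBpCornerAllFive_of_two_facts hBT hH p hp8

/-! ## §2 ★★ The crux body on the families `{B_p}`, `{B_{−2p}}`, `p ≡ 5 (mod 8)` -/

/-- ★★ **THE CRUX BODY FOR EVERY `W = B_p`, `p` PRIME `≡ 5 (mod 8)`, TWO NAMED FACTS**: the body of `HeegnerTwistCouplingInSupply` with the single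
extra hypothesis `∃ p, p.Prime ∧ p % 8 = 5 ∧ W = B_p` (`¬ Good ∧ 5 ≤ p'` force `p' = p`; then `cruxOnBpCornerAllFive_of_two_facts`).
[cite: BurungaleTian2026, Thm. 1.1] [cite: Oesterle1988Gauss, II §3 Proposition p. 57 (27)] -/
theorem heegnerTwistCouplingInSupply_of_eq_B_five (hBT : burungaleTian_analyticRank_eq_zero_of_selmerCorank_eq_zero_of_hasCM)
    (hH : hasEntireLFunction_of_j_mem_maximalCMJInvariants) :
    ∀ (W : WeierstrassCurve ℚ) [W.IsElliptic] [W.IsGloballyMinimal] (p' : ℕ) [Fact p'.Prime] [NeZero (W.conductorNorm ℤ)],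
      (∃ p : ℕ, p.Prime ∧ p % 8 = 5 ∧ W = ⟨0, 4 * (p : ℚ), 0, 2 * (p : ℚ) ^ 2, 0⟩) →
      W.HasCM → W.analyticRank = 1 → 5 ≤ p' → CMInert W p' → ¬ Good W p' →
      (∀ B : ℕ, ∃ (K : Type) (_ : Field K) (_ : NumberField K), IsImaginaryQuadratic K ∧ B < (NumberField.discr K).natAbs ∧
        4 < (NumberField.discr K).natAbs ∧ SatisfiesHeegnerHypothesis (W.conductorNorm ℤ) K ∧ ¬ p' ∣ NumberField.classNumber K) →
      ∃ (K : Type) (_ : Field K) (_ : NumberField K),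
        IsImaginaryQuadratic K ∧ 4 < (NumberField.discr K).natAbs ∧
        SatisfiesHeegnerHypothesis (W.conductorNorm ℤ) K ∧
        (W.quadraticTwist (NumberField.discr K : ℚ)).entireLFunction 1 ≠ 0 ∧ ¬ p' ∣ NumberField.classNumber K := by
  intro W _ _ p' hpF _ hW _ _ h5 _ hbad _
  obtain ⟨p, hp, hp8, rfl⟩ := hW
  obtain rfl := eq_of_not_good_B hp h5 hbad
  obtain ⟨K, iF, iN, hK, h4, hH', hL, -, hndvd⟩ := cruxOnBpCornerAllFive_of_two_facts hBT hH p' hp8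
  exact ⟨K, iF, iN, hK, h4, hH', hL, hndvd⟩

/-- ★★ **THE CRUX BODY FOR EVERY `W = B_{−2p}`, `p` PRIME `≡ 5 (mod 8)`, TWO NAMED FACTS** (via `cruxOnBdualCornerAllFive_of_two_facts`).
[cite: BurungaleTian2026, Thm. 1.1] [cite: Oesterle1988Gauss, II §3 Proposition p. 57 (27)] -/
theorem heegnerTwistCouplingInSupply_of_eq_Bdual_five (hBT : burungaleTian_analyticRank_eq_zero_of_selmerCorank_eq_zero_of_hasCM)
    (hH : hasEntireLFunction_of_j_mem_maximalCMJInvariants) :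
    ∀ (W : WeierstrassCurve ℚ) [W.IsElliptic] [W.IsGloballyMinimal] (p' : ℕ) [Fact p'.Prime] [NeZero (W.conductorNorm ℤ)],
      (∃ p : ℕ, p.Prime ∧ p % 8 = 5 ∧ W = ⟨0, -8 * (p : ℚ), 0, 8 * (p : ℚ) ^ 2, 0⟩) →
      W.HasCM → W.analyticRank = 1 → 5 ≤ p' → CMInert W p' → ¬ Good W p' →
      (∀ B : ℕ, ∃ (K : Type) (_ : Field K) (_ : NumberField K), IsImaginaryQuadratic K ∧ B < (NumberField.discr K).natAbs ∧
        4 < (NumberField.discr K).natAbs ∧ SatisfiesHeegnerHypothesis (W.conductorNorm ℤ) K ∧ ¬ p' ∣ NumberField.classNumber K) →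
      ∃ (K : Type) (_ : Field K) (_ : NumberField K),
        IsImaginaryQuadratic K ∧ 4 < (NumberField.discr K).natAbs ∧
        SatisfiesHeegnerHypothesis (W.conductorNorm ℤ) K ∧
        (W.quadraticTwist (NumberField.discr K : ℚ)).entireLFunction 1 ≠ 0 ∧ ¬ p' ∣ NumberField.classNumber K := by
  intro W _ _ p' hpF _ hW _ _ h5 _ hbad _
  obtain ⟨p, hp, hp8, rfl⟩ := hW
  obtain rfl := eq_of_not_good_Bdual hp h5 hbad
  obtain ⟨K, iF, iN, hK, h4, hH', hL, -, hndvd⟩ := cruxOnBdualCornerAllFive_of_two_facts hBT hH p' hp8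
  exact ⟨K, iF, iN, hK, h4, hH', hL, hndvd⟩

end Summit.BirchSwinnertonDyer.BirchSwinnertonDyer.Theorems.BiquadraticEisensteinDescentHeegnerTwistCouplingInSupplySqrtTwoAllFive

end
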